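import Mathlib
import Summits.Ventures.HodgeRepro2.T6NAut3
import Summits.Ventures.HodgeRepro2.T6N3DatumRich
import Summits.Ventures.HodgeRepro2.T6N2RichForms
import Summits.Ventures.HodgeRepro2.T6N41Placed
import Summits.Ventures.HodgeRepro2.T6N43TwistRead
import Summits.Ventures.HodgeRepro2.T6N43HostRuhl
import Summits.Ventures.HodgeRepro2.T6N3MultHs
import Summits.Ventures.HodgeRepro2.T6N3HypL2Aut
import Summits.Ventures.HodgeRepro2.T6N42RichHost

/-!
# T6NAut4 — the automorphic datum `NAut4 F P`: the M2 carrier with the owners' WAVE-1 objects as fields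
(TARGET-T6 v1.5 §11.0, decisions (2)(a), (6), (7), (8); v4)

Cell pub-hodge-repro2, Tier 6 (README §10), seat t6-lead (gen 18). Version 4 of the M2 carrier, the carrier of the
wave-1 recomposition `HCCMOfPublished₃` (T6MainM3Stmt). A v4 carrier IS a v3 carrier (`NAut4.toNAut3`, an `abbrev`:
every binder of `HCCMOfPublished₂` stated on `M` is stated on `M4.toNAut3` in ₃, and the ₂ → ₃ proof is by `rfl`-level
unfolding); there is no map back. What the four re-cuts are, and which ₂ rows each discharges:

* `d3r : N3DatumRich` (t6-p3, T6N3DatumRich; decision (7)): the N3 datum with both sides RICH — `KliftCont`, `Adjoint`,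
  `CopiesOrthogonal`, `TensorsSpan` are the theorems `N3SideRich.toSide_*` (rows 46 48 52 63 / 68 70 74 85 of ₂);
* `Fm : N2Forms d3r.toDatum` with `hFm : Fm.IsForm` (t6-p5, T6N2RichForms; decision (6)): the N2 datum is ASSEMBLED from
  the four line forms, `d2 := (N2Rich.ofForms Fm hFm).toDatum F P`, so the four EX binders `hfr h₁₁₁ hm he` and `hAdm`
  (rows 18–22) are `N2Rich.explicitShape_forms₃ … rfl` / `admGenerating_forms₃ … rfl` (`NAut4.explicitShape`,
  `NAut4.admGenerating`);
* `sA sB : NSide4`: the side with its N4.1 datum BUNDLED with the placement data `Pl In Sp LQ Kd` (t6-p4, T6N41Placed,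
  `d41p : PlacedLDatum`; decision (8); rows 112–116 / 155–159) and with the N4.3 places FIXED to the Bergman-explicit bundle
  `d43 := (N43Host.BergmanPlaces.hostFockRecEL n₁ n₂ n₃).toPlaces` (t6-p6, T6N43TwistRead / T6N43HostRuhl; decision (2)(a)),
  the archimedean `L`-factors of `d41p.D` read as `N43Host.lvArchRead n₁ n₂ n₃` (`Lv_arch`) — so the five (I-P2) binders
  `hEL₁ hA2f₂ hEL₂ hA2f₃ hEL₃` per side (rows 95–99 / 138–142) and the Bergman bundles `XA XB` with `hxA hxB` (rows 86–88)
  are the theorems `NSide4.hEL₁/₂/₃`, `NSide4.hA2f₂/₃` and `rfl`;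
* the N5 block is unchanged (`ι5 G5 d5`; rows 182–183 are discharged in the statement by t6-p8's place-family seam).

Also here, the two small helpers the ₃ proof consumes by name: `NAut4.shapeA/B` (the L2Aut shape of t6-p3's T6N3HypL2Aut
tied to the carrier's OWN `L²([H])` and `π₀`) and `N42Flath.HostReadings.ofDisplays` / `isReading_ofDisplays` (t6-p5's
host readings assembled from the display-level objects; rows 89 92 / 132 135). Row 27 (`hs`) is t6-p3's own
`RogawskiTrace.hs_of_identity` (T6N3HsSplice), consumed by the proof directly. Nothing is constructed; no display is stated
here. §8(d): uses an L-value-free non-vanishing device: NO.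
-/

namespace Summit.Ventures.HodgeRepro2.T6

open scoped InnerProductSpace
open Summit.Ventures.HodgeRepro2.T5TrivialPartner

/-! ### The side, v4: the N4.1 bundle and the Bergman-explicit N4.3 places -/

/-- THE N4 DATA OF ONE SIDE, v4: the N4.2 datum `d42` as in `NSide`, the N4.1 datum BUNDLED with its placement data
(`d41p : PlacedLDatum`, t6-p4), the three Bergman weights `n₁ n₂ n₃` of the N4.3 places (the places themselves are
`(hostFockRecEL n₁ n₂ n₃).toPlaces`, `NSide4.d43`), the reading of the archimedean `L`-factors of `d41p.D` as the
Eischen–Liu factors of those weights (`Lv_arch`, t6-p6's `lvArchRead`), and the finite-place identification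
`theta_fin` of `NSide`. -/
structure NSide4 where
  /-- the N4.2 datum: the finite places of `F⁺` with the local dual pairs, the Witt towers and the zeta data -/
  d42 : N42Datum.FinitePlacesDatum
  /-- the Bergman weight at the compact place `τ′₁` -/
  n₁ : ℤ
  /-- the Bergman weight at `τ′₂` -/
  n₂ : ℤ
  /-- the Bergman weight at `τ′₃` -/
  n₃ : ℤ
  /-- the N4.1 datum over all places `d42.Place ⊕ Fin 3` bundled with the placement data `Pl In Sp LQ Kd` (t6-p4) -/
  d41p : PlacedLDatum (d42.Place ⊕ Fin 3)
  /-- the archimedean `L`-factors of the N4.1 datum are the Eischen–Liu factors of the Bergman weights -/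
  Lv_arch : ∀ j : Fin 3, d41p.D.Lv (Sum.inr j) = N43Host.lvArchRead n₁ n₂ n₃ j
  /-- `[compat: owners t6-p4, t6-p5; discharged at: residual IR]` the identification of «the local theta lift of
  `π₀,v` is non-zero» at the finite places, as in `NSide.theta_fin` -/
  theta_fin : ∀ v : d42.Place, d41p.D.thetaNonzero (Sum.inl v) ↔ d42.ThetaNonzeroAt v

namespace NSide4

variable (s : NSide4)

/-- THE N4.3 PLACES OF THE SIDE: the Bergman-explicit bundle of t6-p6 at the side's weights (decision (2)(a)). -/
noncomputable abbrev d43 : N43Places := (N43Host.BergmanPlaces.hostFockRecEL s.n₁ s.n₂ s.n₃).toPlaces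

/-- THE FORGETFUL BRIDGE to the v3 side (`NSide`): `d41 := d41p.D`, `d43 := NSide4.d43`. -/
noncomputable abbrev toNSide : NSide where
  d42 := s.d42
  d43 := s.d43
  d41 := s.d41p.D
  theta_fin := s.theta_fin

/-- `toNSide.d42 = d42`. -/
theorem toNSide_d42 : s.toNSide.d42 = s.d42 := rfl

/-- `toNSide.d43 = (hostFockRecEL n₁ n₂ n₃).toPlaces`. -/
theorem toNSide_d43 : s.toNSide.d43 = (N43Host.BergmanPlaces.hostFockRecEL s.n₁ s.n₂ s.n₃).toPlaces := rfl

/-- `toNSide.d41 = d41p.D`. -/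
theorem toNSide_d41 : s.toNSide.d41 = s.d41p.D := rfl

/-- THE EISCHEN–LIU DISPLAY AT `τ′₁` IS A THEOREM on the side (row 95 / 138 of ₂): `hostFockRecEL_EL₁` read through
`Lv_arch`. -/
theorem hEL₁ : Hyp.EischenLiu2024_Sec2_2 2 0 s.d43.τ₁ s.d43.ν₁ s.d43.r₁ (s.d41p.D.Lv (Sum.inr 0)) := by
  rw [s.Lv_arch 0, N43Host.lvArchRead_zero]
  exact N43Host.hostFockRecEL_EL₁ s.n₁ s.n₂ s.n₃

/-- THE EISCHEN–LIU DISPLAY AT `τ′₂` IS A THEOREM on the side (row 97 / 140 of ₂). -/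
theorem hEL₂ : Hyp.EischenLiu2024_Sec2_2 1 1 s.d43.τ₂ s.d43.ν₂ s.d43.r₂ (s.d41p.D.Lv (Sum.inr 1)) := by
  rw [s.Lv_arch 1, N43Host.lvArchRead_one]
  exact N43Host.hostFockRecEL_EL₂ s.n₁ s.n₂ s.n₃

/-- THE EISCHEN–LIU DISPLAY AT `τ′₃` IS A THEOREM on the side (row 99 / 142 of ₂). -/
theorem hEL₃ : Hyp.EischenLiu2024_Sec2_2 1 1 s.d43.τ₃ s.d43.ν₃ s.d43.r₃ (s.d41p.D.Lv (Sum.inr 2)) := by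
  rw [s.Lv_arch 2, N43Host.lvArchRead_two]
  exact N43Host.hostFockRecEL_EL₃ s.n₁ s.n₂ s.n₃

/-- THE RÜHL DISPLAY AT `τ′₂` IS A THEOREM on the side (row 96 / 139 of ₂): t6-p6's `hostFockRecEL_A2f₂`. -/
theorem hA2f₂ : Hyp.Ruhl1970_A2f s.d43.d₂ := N43Host.hostFockRecEL_A2f₂ s.n₁ s.n₂ s.n₃

/-- THE RÜHL DISPLAY AT `τ′₃` IS A THEOREM on the side (row 98 / 141 of ₂): t6-p6's `hostFockRecEL_A2f₃`. -/
theorem hA2f₃ : Hyp.Ruhl1970_A2f s.d43.d₃ := N43Host.hostFockRecEL_A2f₃ s.n₁ s.n₂ s.n₃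

end NSide4

/-! ### The carrier, v4 -/

variable {K : Type*} [Field K] [NumberField K] [NumberField.IsCMField K]

/-- THE AUTOMORPHIC DATUM OF THE WAVE-1 RECOMPOSITION, v4: `NAut3` with `d3` RICH (`d3r`), the N2 datum ASSEMBLED from
the four line forms (`Fm`, `hFm`; `d2 := (N2Rich.ofForms Fm hFm).toDatum F P`), the sides `NSide4`, and the N5 block
of v3 unchanged. Every field is an object or a law of the owners' lanes; `toNAut3` forgets the richness. -/
structure NAut4 (F : FaceSetting K) (P : NDatum F) where
  /-- the N3 datum, RICH on both sides (t6-p3, `T6N3DatumRich`) -/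
  d3r : N3DatumRich
  /-- the Schwartz data of a choice `c` of the period datum (as in `NAut3.data`) -/
  data : P.Choice → d3r.toDatum.A.Sa × d3r.toDatum.A.Sb × d3r.toDatum.B.Sa × d3r.toDatum.B.Sb
  /-- the four line forms of the N2 datum (t6-p5, `T6N2RichForms`): the admissible choices of the lines `111`, `100`,
  `101`, `110` with their readings as Schwartz data -/
  Fm : N2Forms d3r.toDatum
  /-- the laws of the four line forms (`N2Forms.IsForm`) -/
  hFm : Fm.IsForm
  /-- `[compat: owners t6-lead, t6-p5, t6-p3; discharged at: B7(b) / Lemma A7.3(b) on the host]` CONDITIONAL RICHNESS as in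
  `NAut3.data_adm'`, stated on the assembled N2 datum -/
  data_adm' : ((N2Rich.ofForms Fm hFm).toDatum F P).Adm →
    ∀ (φa : d3r.toDatum.A.Sa) (φb : d3r.toDatum.A.Sb) (φc : d3r.toDatum.B.Sa) (φd : d3r.toDatum.B.Sb),
    ((N2Rich.ofForms Fm hFm).toDatum F P).AdmData (φa, φb, φc, φd) →
    ⟪d3r.toDatum.B.F φc φd, d3r.toDatum.A.F φa φb⟫_ℂ ≠ 0 →
    ∃ c, P.AdmChoice c ∧
      ⟪d3r.toDatum.B.F (data c).2.2.1 (data c).2.2.2, d3r.toDatum.A.F (data c).1 (data c).2.1⟫_ℂ ≠ 0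
  /-- the N1 datum in N3's parameter shape (as in `NAut3.d1`) -/
  d1 : N1Datum F P d3r.toDatum.LG (fun c => d3r.toDatum.A.F (data c).1 (data c).2.1)
    (fun c => d3r.toDatum.B.F (data c).2.2.1 (data c).2.2.2)
  /-- the N4 data of side A, v4 -/
  sA : NSide4
  /-- the N4 data of side B, v4 -/
  sB : NSide4
  /-- the index type of the toric data of N5 -/
  ι5 : Type
  /-- the (abelian) torus of N5 -/
  G5 : Type
  [instG5 : CommGroup G5]
  /-- the N5 datum (t6-p7, `T6N5Skeleton`) -/
  d5 : N5Skeleton.N5Data ι5 G5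
  /-- `[compat: owners t6-p3, t6-p7; discharged at: residual IR]` N5's conclusion on side A is Proposition N*'s
  hypothesis (ii) for side A -/
  hypII_A_of_N5 : d5.A.levelPeriodNonzero → d3r.toDatum.A.hypII
  /-- `[compat: owners t6-p3, t6-p7; discharged at: residual IR]` the same on side B -/
  hypII_B_of_N5 : d5.B.levelPeriodNonzero → d3r.toDatum.B.hypII

namespace NAut4

variable {F : FaceSetting K} {P : NDatum F} (M : NAut4 F P)

/-- the group structure of the N5 torus (field) -/
instance : CommGroup M.G5 := M.instG5

/-- THE FORGETFUL BRIDGE to the v3 carrier: `d3 := d3r.toDatum`, `d2 := (N2Rich.ofForms Fm hFm).toDatum F P`,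
the sides through `NSide4.toNSide`; an `abbrev`, so that every binder of `HCCMOfPublished₂` at `M.toNAut3` reads its
fields off `M`. -/
noncomputable abbrev toNAut3 : NAut3 F P where
  d3 := M.d3r.toDatum
  data := M.data
  d2 := (N2Rich.ofForms M.Fm M.hFm).toDatum F P
  data_adm' := M.data_adm'
  d1 := M.d1
  sA := M.sA.toNSide
  sB := M.sB.toNSide
  ι5 := M.ι5
  G5 := M.G5
  instG5 := M.instG5
  d5 := M.d5
  hypII_A_of_N5 := M.hypII_A_of_N5
  hypII_B_of_N5 := M.hypII_B_of_N5

/-- `toNAut3.d2` is the assembled datum (`rfl`). -/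
theorem toNAut3_d2 : M.toNAut3.d2 = (N2Rich.ofForms M.Fm M.hFm).toDatum F P := rfl

/-- THE FOUR EX BINDERS `hfr h₁₁₁ hm he` OF ₂ (rows 18–21) ARE A THEOREM on the v4 carrier: t6-p5's
`explicitShape_forms₃` with the construction equation `rfl`. -/
theorem explicitShape : N2Contract3.ExplicitShape M.toNAut3 :=
  N2Rich.explicitShape_forms₃ M.toNAut3 M.Fm M.hFm rfl

/-- `hAdm` OF ₂ (row 22) IS A THEOREM on the v4 carrier: t6-p5's `admGenerating_forms₃` with `rfl`. -/
theorem admGenerating : M.toNAut3.d2.AdmGenerating :=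
  N2Rich.admGenerating_forms₃ M.toNAut3 M.Fm M.hFm rfl

/-- THE L2AUT SHAPE OF SIDE A tied to the carrier: t6-p3's `L2AutShape` (T6N3HypL2Aut) with `L2 := L²([H])` and
`π₀` the carrier's own (`d3r.A.LH`, `d3r.A.π₀`), the finite-part shape `S` and the two printed predicates given. -/
noncomputable abbrev shapeA (S : N42Flath.FactorizationShape) (IsL2Aut IsFin : Submodule ℂ M.d3r.A.LH → Prop) :
    N3L2Aut.L2AutShape where
  S := S
  L2 := M.d3r.A.LH
  π₀ := M.d3r.A.π₀
  IsL2Aut := IsL2Aut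
  IsFinitePart := IsFin

/-- THE L2AUT SHAPE OF SIDE B tied to the carrier. -/
noncomputable abbrev shapeB (S : N42Flath.FactorizationShape) (IsL2Aut IsFin : Submodule ℂ M.d3r.B.LH → Prop) :
    N3L2Aut.L2AutShape where
  S := S
  L2 := M.d3r.B.LH
  π₀ := M.d3r.B.π₀
  IsL2Aut := IsL2Aut
  IsFinitePart := IsFin

end NAut4

/-! ### The host readings of the N4.2 block from the display-level objects -/

namespace N42Flath.HostReadings

variable {D : N42Datum.FinitePlacesDatum}
variable {LH : Type} [NormedAddCommGroup LH] [InnerProductSpace ℂ LH] {Hf : Type} [Group Hf]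
  {R : Hf → LH →ₗᵢ[ℂ] LH} {π₀ : Submodule ℂ LH}

/-- THE HOST READINGS OF A SIDE FROM THE DISPLAYS (t6-p5's `HostReadings`, its Flath reading `FlathReading.ofDisplays`):
the first-lift side `F` under its laws, the factorization shape with its two displays and the admissible-irreducible
fact, the places and readings of `π₀,v`, and the reading of `F`'s global datum at every non-split place. -/
noncomputable def ofDisplays (F : FirstLiftSide LH Hf R π₀) (hF : F.IsLift) (S : FactorizationShape)
    (h₁ : Hyp.GetzHahn2024_Thm5_7_1 S) (h₂ : Hyp.GetzHahn2024_Sec5_7_Note S) (hW : S.AdmissibleIrreducible)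
    (sp : D.SplitPlace → S.Place) (ns : D.NonsplitPlace → S.Place)
    (readSplit : ∀ v, ReadAs (S.components h₁ h₂ hW (sp v)) (D.splitDatum v).pair.π)
    (readNonsplit : ∀ v, ReadAs (S.components h₁ h₂ hW (ns v)) (D.towerDatum v).π)
    (read : ∀ v : D.NonsplitPlace,
      ReadAtPlace (F.toGlobalLiftDatum hF) ((D.towerDatum v).ω 0) (D.towerDatum v).π (charLinRep (D.β' v))) :
    HostReadings D F hF where
  flath := FlathReading.ofDisplays S h₁ h₂ hW sp ns readSplit readNonsplit
  read := read

/-- … and their laws from the readings' laws, `0 < n` and `n ≤ m` at the split places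
(`FlathReading.isReading_ofDisplays` for the Flath reading). -/
theorem isReading_ofDisplays (F : FirstLiftSide LH Hf R π₀) (hF : F.IsLift) (S : FactorizationShape)
    (h₁ : Hyp.GetzHahn2024_Thm5_7_1 S) (h₂ : Hyp.GetzHahn2024_Sec5_7_Note S) (hW : S.AdmissibleIrreducible)
    (sp : D.SplitPlace → S.Place) (ns : D.NonsplitPlace → S.Place)
    (readSplit : ∀ v, ReadAs (S.components h₁ h₂ hW (sp v)) (D.splitDatum v).pair.π)
    (readNonsplit : ∀ v, ReadAs (S.components h₁ h₂ hW (ns v)) (D.towerDatum v).π)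
    (read : ∀ v : D.NonsplitPlace,
      ReadAtPlace (F.toGlobalLiftDatum hF) ((D.towerDatum v).ω 0) (D.towerDatum v).π (charLinRep (D.β' v)))
    (hsp : ∀ v, (readSplit v).IsReading) (hns : ∀ v, (readNonsplit v).IsReading)
    (pos : ∀ v, 0 < (D.splitDatum v).n) (sizes : D.TypeIISizes) (hread : ∀ v, (read v).IsReading) :
    (ofDisplays F hF S h₁ h₂ hW sp ns readSplit readNonsplit read).IsReading where
  flath := FlathReading.isReading_ofDisplays S h₁ h₂ hW sp ns readSplit readNonsplit hsp hns
  pos := pos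
  sizes := sizes
  read := hread

end N42Flath.HostReadings

end Summit.Ventures.HodgeRepro2.T6
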